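import Summits.QuantumFields.BalabanUV.T4Continuum.Spine.NE1p.DressedSmallFieldInnerLink
import Summits.QuantumFields.BalabanUV.T4Continuum.Support.TorusBlockRefinement

/-!
# T⁴ programme, spine estimate NE1′ (node O3b/H2) — N0u's INNER-LABEL END ON pv22's NESTED TORI `(N, L·N)` WITH BOTH GEOMETRIC
# BINDERS SUPPLIED: the footprint map `foot := trefineDom L N` with `hmono` (S43.1, [Dimock2013] Lemma 10 BY NAME) AND the
# (2.27)∘(2.32) link `hlink` (S40.1's `…innerLabels_of_units` ∕ `link_of_ineq227` at the FINE torus's unit cubes, `c₃₂ = 5`) — the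
# junction of the crew's two nested-tori constructions in one END

Cell `pub-balaban`, sub-cell `t4`, BINDER-OWNERS row NE1′ (owner lineage t4-ne1p-p1); crew seat `b2b-balaban-t4-ne1p-formalise-leaf-05`
(LEAF PROVER 05, generation 11); crew row (INTENT `CLAIMS.log` 2026-08-20).  ADDITIVE — imports S40 PART 1
`Spine/NE1p/DressedSmallFieldInnerLink` (⇒ the owner's N0u `DressedSmallFieldInnerCount`, S24) and S43 PART 1 `Support/TorusBlockRefinement`
ONLY; THEOREMS ONLY (0 `def`, 0 `def … : Prop`); nothing of N0u ∕ S40 ∕ S43 ∕ S24 ∕ pv22 restated — their declarations are used BY NAME.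

WHY THIS FILE.  S40.1 §4 reads N0u's inner-label END on ONE torus (`G = Gk := tgeometry 4 N`, `foot := id`, `hmono := le_rfl`) with the
link DISCHARGED; S43 constructed the refinement `trefineDom L N : (tsys 4 N).Dom → (tsys 4 (L·N)).Dom` between pv22's NESTED tori and
discharged `hmono` by exact coarsening.  THIS FILE composes the two: `attachedPart_locE_le_of_coresAt_pencil_innerLabels_refined` = S40.1's
`attachedPart_locE_le_of_coresAt_pencil_innerLabels_of_units` ONCE BY NAME at `D := tsys 4 N`, `G := tgeometry 4 N`, `Dk := tsys 4 (L·N)`,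
`Gk := tgeometry 4 (L·N)`, `foot := trefineDom L N`, `hmono := torusTreeLen_le_trefine`, `unit a := ⟨{a}, _⟩` (the fine torus's single
cubes, `u₀ = 0` by pv22's `torusTreeLen_singleton`), constants located at BOTH scales by N0o `torus_consts` ∕ S24 `K₀_four` (ν = 9,
κ₀ = 64·log 162, c₁ = 64, K₀ = `K₀ 64 8` on either torus; `b₅ := 5·r₁`).  In the resulting END the inner labels `⟨W, (𝐃, P)⟩` live on the
REFINED footprint: `W ⊆ (trefineDom L N Z).1` (fine cubes of the blocks of `Z`), `𝐃` a covering family of `(trefineDom L N Z).1 ∖ W` by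
localization domains of the FINE torus, `P ⊆ bondsOf W`; NO footprint map, NO `hmono`, NO link binder, NO geometry hypothesis remain.
WHAT STAYS DISPLAYED: the operator letters `hm`∕`hN`∕`hq`, room, class radii, `hscale`∕`hact`; `hadm` (the terms of `Z` ARE inner labels
of its refined footprint — (B1b) READING); (B3-amp) `hAmp`; the bonds-per-cube clause `hb₀`∕`bondsOf`; `hs0`∕`hs1`∕`ht`; the located
clauses `64·log 162 + 1 ≤ δκ`, `e·K₀(64,8)·64·α₆ ≤ 1`, `r₁ + 2·(64·log 162) + 2 ≤ Rkp ≤ R − 64·(e^{5R}·s·e^{b₀t})`,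
`(A₀ + ϱA₁)·e^{5r₁+1}·K₀(64,8)·9·64 ≤ 1`, N0m's `hϱ`∕`hϱA` ((B5): SHAPES consumed BY NAME; their standing against print's NUMBERS is NOT
asserted).  WHICH pair `(N, L·N)` of nested tori is Bałaban's `(𝐃_{k+1}, 𝐃_k)` and `L` his scaling integer stay pv22's READING
(DIVERGENCE D-pv22.3), not asserted; print's (2.32) constant `4` vs the typed `5` = S40's record (G-B13-08), TYPE∕CONTEXT; 0 binders
instantiated on Bałaban's densities; no new inequality; no wall item moves; the wall line (v1.7 of record, T4-DAG v47) does NOT move;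
R-t4r2-Q2 NOT met thereby.
HONEST FRAMING.  Kernel bookkeeping: one by-name application joining two landed crew constructions; the cores ∕ inner labels are the cell's
typed FORMAT of (2.14) and of print's second resummation step, NOT Bałaban's functions; printed loci ([Balaban1988RGII] (2.27)–(2.34)
pp. 17–19, (2.36) p. 19; [Balaban1987RGI] p. 251, p. 257; [Dimock2013] §3 Lemma 10) are TYPE ∕ CONTEXT through the imported cite-tagged
Literature modules, re-asserted nowhere; ABSOLUTE RULE honoured ([folklore] kernel lemmas only).  NE1′ ⇐ the named binders — NOT printed,
NOT proved; spine PROVED 0∕9; count 9 unchanged.  Rung (B)+1 on ONE finite four-torus — NOT infinite volume, NOT a mass gap, NOT OS on ℝ⁴,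
NOT Clay.  HONEST DEPENDENCY: continuum YM on T⁴ ⇐ BetaPertH ∧ nine spine estimates (0/9 proved); BetaPertH ⇐ (D1) ∧ (D4) ∧ CAP+tail;
G-an2-4 gates asym, D1 and NE2/3/4.
-/
noncomputable section

namespace Summit.QuantumFields.BalabanUV.T4Continuum.NE1p.DressedSmallFieldInnerLabelsRefined

open Metric Set Complex MeasureTheory
open scoped BigOperators
open Literature.MathematicalPhysics.QuantumFieldTheory.Balaban1983to89.T4OutputRate (Carriers)
open Literature.MathematicalPhysics.QuantumFieldTheory.Balaban1983to89.B13Resummation (locE)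
open Literature.MathematicalPhysics.QuantumFieldTheory.Balaban1983to89.B13FamilySum (coveringFamilies)
open Literature.MathematicalPhysics.QuantumFieldTheory.Balaban1983to89.TreeLengthTorus (TPt TDom IsTDom tsys torusTreeLen
  torusTreeLen_singleton)
open Literature.MathematicalPhysics.QuantumFieldTheory.Balaban1983to89.TreeLengthTorusGeometry (TTouch tgeometry)
open Literature.MathematicalPhysics.QuantumFieldTheory.Balaban1983to89.B12TreeDecay (K₀)
open Summit.QuantumFields.BalabanUV.T4Continuum.B13HistMeasurable (MeasPotFrame B13HistM)
open Summit.QuantumFields.BalabanUV.T4Continuum.B13TermParamGaussianBi (BiCore)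
open Summit.QuantumFields.BalabanUV.T4Continuum.TorusBlockRefinement (trefineDom torusTreeLen_le_trefine)
open Summit.QuantumFields.BalabanUV.T4Continuum.NE1p.DressedSmallFieldInnerLink
  (attachedPart_locE_le_of_coresAt_pencil_innerLabels_of_units)
open Summit.QuantumFields.BalabanUV.T4Continuum.NE1p.DressedSmallFieldGeometry (torus_consts)
open Summit.QuantumFields.BalabanUV.T4Continuum.NE1p.DressedSmallFieldGeometryFaces (K₀_four)

variable {N : ℕ} [NeZero N] {L : ℕ} [NeZero L]
variable {C : Carriers} {P : MeasPotFrame C} {Op : Type*} [NormedAddCommGroup Op] [NormedSpace ℂ Op] {Bnd : Type} [DecidableEq Bnd]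
  {𝒴 : ℕ → (Σ _ : Finset (TPt 4 (L * N)), Finset (TDom 4 (L * N)) × Finset Bnd) → Type*} {dom : ∀ k i, 𝒴 k i → C.Dom}
  {β : ℕ → (Σ _ : Finset (TPt 4 (L * N)), Finset (TDom 4 (L * N)) × Finset Bnd) → Type*} [∀ k i, MeasurableSpace (β k i)]
  {α : ℕ → (Σ _ : Finset (TPt 4 (L * N)), Finset (TDom 4 (L * N)) × Finset Bnd) → Type*} [∀ k i, NormedAddCommGroup (α k i)]
  [∀ k i, InnerProductSpace ℝ (α k i)] [∀ k i, FiniteDimensional ℝ (α k i)] [∀ k i, MeasurableSpace (α k i)]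
  [∀ k i, BorelSpace (α k i)]

open Classical in
/-- **N0u's INNER-LABEL END ON THE NESTED TORI `(N, L·N)` — NO FOOTPRINT MAP, NO `hmono`, NO LINK BINDER, NO GEOMETRY HYPOTHESIS**
(kernel; S40.1's `attachedPart_locE_le_of_coresAt_pencil_innerLabels_of_units` ONCE BY NAME at `D := tsys 4 N`, `G := tgeometry 4 N`,
`Dk := tsys 4 (L·N)`, `Gk := tgeometry 4 (L·N)`, `foot := trefineDom L N`, `hmono := torusTreeLen_le_trefine` (S43.1), the fine torus's
single cubes as unit domains (`u₀ = 0`), constants located at both scales): cores indexed by inner labels `⟨W, (𝐃, P)⟩` of the REFINED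
footprint `(trefineDom L N Z).1` (`hadm`), per-label AMPLITUDE `hAmp`, bonds-per-cube clause `hb₀`, the located clauses and rate bookkeeping
`Rkp ≤ R − 64·(e^{5R}·s·e^{b₀t})`, N0m's `hϱ`∕`hϱA`: the attached part is `≤ 4·(e·9·64·K₀(64,8)²)·A₁·e^{−r₁·torusTreeLen X₀}`. [folklore] -/
theorem attachedPart_locE_le_of_coresAt_pencil_innerLabels_refined {Win : Set (ℕ → ℝ)}
    {ctr : ℕ → (ℕ → ℝ) → C.BgB → Op × B13HistM P} {ROp RHist R' : ℕ → ℝ}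
    (𝔊 : ∀ k i, C.Dom → BiCore P (dom k i) Op (β k i) (α k i))
    {mq bq N₀ : ℕ → (Σ _ : Finset (TPt 4 (L * N)), Finset (TDom 4 (L * N)) × Finset Bnd) → C.Dom → ℝ}
    (hroom : ∀ k, ROp k < R' k)
    (hm : ∀ k, ∀ g ∈ Win, ∀ (U : C.BgB) (X : C.Dom), C.scale X = k → ∀ i, 0 < mq k i X)
    (hN : ∀ k, ∀ g ∈ Win, ∀ (U : C.BgB) (X : C.Dom), C.scale X = k → ∀ i,
      (∀ o ∈ ball (ctr k g U).1 (R' k), AEStronglyMeasurable ((𝔊 k i X).N o) (𝔊 k i X).lam) ∧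
      (∀ p, DifferentiableOn ℂ (fun o => (𝔊 k i X).N o p) (ball (ctr k g U).1 (R' k))) ∧
      (∀ o ∈ ball (ctr k g U).1 (R' k), ∀ p, ‖(𝔊 k i X).N o p‖ ≤ N₀ k i X))
    (hq : ∀ k, ∀ g ∈ Win, ∀ (U : C.BgB) (X : C.Dom), C.scale X = k → ∀ i,
      (∀ o ∈ ball (ctr k g U).1 (R' k),
        AEStronglyMeasurable (Function.uncurry ((𝔊 k i X).q o)) ((𝔊 k i X).lam.prod volume)) ∧
      (∀ p v, DifferentiableOn ℂ (fun o => (𝔊 k i X).q o p v) (ball (ctr k g U).1 (R' k))) ∧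
      (∀ o ∈ ball (ctr k g U).1 (R' k), ∀ p v, mq k i X * ‖v‖ ^ 2 - bq k i X ≤ ((𝔊 k i X).q o p v).re))
    {k : ℕ} {g : ℕ → ℝ} (hg : g ∈ Win) {U : C.BgB} {o : Op} {h₀ w : B13HistM P} {ϱ : ℝ}
    (hO : ‖o - (ctr k g U).1‖ ≤ ROp k) (hH : ‖h₀ - (ctr k g U).2‖ + ϱ * ‖w‖ ≤ RHist k)
    {emb : (tsys 4 N).Dom → C.Dom} (hscale : ∀ Z, C.scale (emb Z) = k)
    {terms : (tsys 4 N).Dom → Finset (Σ _ : Finset (TPt 4 (L * N)), Finset (TDom 4 (L * N)) × Finset Bnd)}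
    {act : ℂ → (tsys 4 N).Dom → ℂ}
    (hact : ∀ σ ∈ ball (0 : ℂ) ϱ, ∀ Z, act σ Z = ∑ i ∈ terms Z, (𝔊 k i (emb Z)).termAt o (h₀ + σ • w))
    {A₀ A₁ Rkp r₁ : ℝ} (X₀ : (tsys 4 N).Dom) (hA₀ : 0 ≤ A₀) (hA₁ : 0 ≤ A₁) (hr₁ : 0 ≤ r₁)
    (hrate : r₁ + 2 * (64 * Real.log 162) + 2 ≤ Rkp)
    (hsmall : (A₀ + ϱ * A₁) * Real.exp (5 * r₁ + 1) * K₀ 64 8 * 9 * 64 ≤ 1)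
    (bondsOf : Finset (TPt 4 (L * N)) → Finset Bnd) {δ κ α₆ R b₀ s t : ℝ} (hα₆ : 0 ≤ α₆)
    (hκ : 64 * Real.log 162 + 1 ≤ δ * κ) (h229 : Real.exp 1 * K₀ 64 8 * 64 * α₆ ≤ 1)
    (hs0 : 0 ≤ s) (hs1 : s ≤ 1) (ht : 0 ≤ t) (hb₀ : ∀ W, ((bondsOf W).card : ℝ) ≤ b₀ * W.card)
    (hRR : Rkp ≤ R - 64 * (Real.exp (R * 5) * s * Real.exp (b₀ * t)))
    (hadm : ∀ Z : (tsys 4 N).Dom, ∀ l ∈ terms Z, l.1 ⊆ (trefineDom L N Z).1 ∧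
      l.2.1 ∈ coveringFamilies Finset.univ (fun Y : (tsys 4 (L * N)).Dom => Y.1) ((trefineDom L N Z).1 \ l.1) ∧
        l.2.2 ⊆ bondsOf l.1 ∧ l.1.card ≤ 2 * l.2.2.card)
    (hAmp : ∀ Z : (tsys 4 N).Dom, Z.1 ⊆ X₀.1 → ∀ l ∈ terms Z,
      (𝔊 k l (emb Z)).lam.real univ * ((𝔊 k l (emb Z)).wB * N₀ k l (emb Z) * Real.exp (bq k l (emb Z))) *
          (Real.pi / (mq k l (emb Z) / 2)) ^ (Module.finrank ℝ (α k l) / 2 : ℝ) *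
        Real.exp ((𝔊 k l (emb Z)).N₁ * (‖h₀‖ + ϱ * ‖w‖)) ≤
      (A₀ + ϱ * A₁) * ((∏ Y ∈ l.2.1, (α₆ * Real.exp (-(δ * κ * torusTreeLen Y.1)) *
        Real.exp (-(R * (torusTreeLen Y.1 + 5))))) * (s ^ 2 * t) ^ l.2.2.card))
    (hϱ : 2 ≤ ϱ) (hϱA : A₀ ≤ ϱ * A₁) :
    ‖locE (TTouch (d := 4) (N := N)) (fun Z : (tsys 4 N).Dom => Z.1) (act 1) X₀.1 -
        locE (TTouch (d := 4) (N := N)) (fun Z : (tsys 4 N).Dom => Z.1) (act 0) X₀.1‖ ≤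
      4 * (Real.exp 1 * 9 * 64 * K₀ 64 8 ^ 2) * A₁ * Real.exp (-(r₁ * torusTreeLen X₀.1)) := by
  obtain ⟨hν, hκ₀, hc⟩ := torus_consts N
  obtain ⟨-, hκ₀L, hcL⟩ := torus_consts (L * N)
  have hK₀ := K₀_four (N := N)
  have hK₀L := K₀_four (N := L * N)
  have hdom : ∀ a : TPt 4 (L * N), IsTDom ({a} : Finset (TPt 4 (L * N))) := fun a =>
    ⟨Finset.singleton_nonempty a, fun x hx y hy => by
      rw [Finset.mem_singleton] at hx hy; subst hx; subst hy; exact Relation.ReflTransGen.refl⟩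
  have h := attachedPart_locE_le_of_coresAt_pencil_innerLabels_of_units (tsys 4 N) (tgeometry 4 N) (tgeometry 4 (L * N)) 𝔊 hroom
    hm hN hq hg hO hH hscale hact (Rkp := Rkp) (b₅ := 5 * r₁) (X₀ := X₀) hA₀ hA₁ hr₁ (le_of_eq (by ring))
    (by rw [hκ₀]; exact hrate) (by rw [hK₀, hν, hc]; exact hsmall) (trefineDom L N) (fun Z => torusTreeLen_le_trefine Z) bondsOf hα₆
    (by rw [hκ₀L]; exact hκ) (by rw [hK₀L, hcL]; exact h229) hs0 hs1 ht hb₀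
    (fun a => (⟨{a}, hdom a⟩ : TDom 4 (L * N))) (fun _ => rfl) (u₀ := 0) (fun a => le_of_eq (torusTreeLen_singleton a))
    (by rw [hcL, show (5 : ℝ) + 0 = 5 by norm_num]; exact hRR) hadm hAmp hϱ hϱA
  rw [hν, hc, hK₀] at h
  exact h

end Summit.QuantumFields.BalabanUV.T4Continuum.NE1p.DressedSmallFieldInnerLabelsRefined

end
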